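import Summits.HodgeConjecture.HodgeConjecture.Theses.HeckePrymWeil
import Summits.HodgeConjecture.HodgeConjecture.Theorems.HeckePrymWeilWeilTwelvefoldsSqrtMinus7Descent
import Summits.HodgeConjecture.HodgeConjecture.Theorems.HeckePrymWeilWeilTwelvefoldsSqrtMinus7HodgeTypeExterior
import Literature.AlgebraicGeometry.Motives.AbelianVarietyProduct
import Literature.AlgebraicGeometry.Motives.AbelianVarietyProductDimProofs
import Literature.AlgebraicGeometry.Motives.HyperbolicWeilType
import Literature.AlgebraicGeometry.HodgeTheory.WeilClassesFourfoldsProofs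
import Literature.NumberTheory.Transcendental.DeRhamTheoremMultiplicative
import HarnessLib

/-!
# Crux `WeilTwelvefoldsSqrtMinus7` (stmt-HodgeConjecture-1261), line `amnesic-secant-sheaves-split-fourteenfolds` —
# the composition of reshape r4: split fourteenfolds + the aimed partner ⟹ the crux

The line's skeleton (`Cruxes/WeilTwelvefoldsSqrtMinus7/Lines/amnesic_secant_sheaves_split_fourteenfolds.lean`,
reshape r4, 2026-08-16) proves the crux — Hodge–Weil classes are algebraic on EVERY `ℚ(√-7)`-Weil abelian
12-fold — from exactly two open statements: S1, the Hodge–Weil classes of HYPERBOLIC (split) polarised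
`ℚ(√-7)`-Weil 14-folds (= the route's split-rung predicate `X′(7,7)`, open mathematics: Markman's
"dimension ≥ 8" question for one component), and S7, the aiming lemma of the product trick
(`Motives.exists_cmWeilSurface_aimedSplitProduct_of_ne_one_of_ne_three`, a Literature named fact: van Geemen
LNM 1594 Lemma 5.2 (3), 5.3, 5.4 (5.4.1); Markman arXiv:2509.23403 §11.5 Step 2; Schoen 1998 §10). This file
lands that composition SORRY-FREE on the tree's real carriers, with both open statements as explicit
hypotheses and everything else PROVED: Künneth for Hodge types (`stub_hodgeTypeExterior`, p91489) fed with
de Rham's theorem in multiplicative form (`exists_deRhamIsoFamily_holds`, a theorem since 2026-08-16), and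
Schoen's descent `14 → 12` along the real Gysin map (`stub_descent`, p91102).

* `weilTwelvefolds_of_splitFourteenfolds_of_aimedPartner` — S1 + the aimed partner AT `d = 7`, `n = 6`
  (the line's S3: for every Weil-type 12-fold a Weil surface with a descent pair and a hyperbolic
  `K`-symmetrised hyperplane class on the product) ⟹ crux;
* `weilTwelvefolds_of_splitFourteenfolds_of_aimedSplitProduct` — S1 + the named fact (verbatim text, all
  `d ∉ {1,3}`, all `n`) ⟹ crux.

Compared with the landed glue `weilTwelvefolds_of_splitFourteenfolds_of_aimedDescending` (p92016, hypothesis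
= the route's whole lever `AimedDescending`), the hypothesis here is only the AIMING half at one `(d, n)`;
the descent half is discharged.
-/

noncomputable section

set_option linter.dupNamespace false

open CategoryTheory Complex
open scoped Manifold
open Literature.AlgebraicGeometry Literature.AlgebraicGeometry.Motives
  Literature.AlgebraicGeometry.HodgeTheory Literature.AlgebraicTopology.SingularHomology
open Summit.HodgeConjecture.HodgeConjecture.Theses.HeckePrymWeil

namespace Summit.HodgeConjecture.HodgeConjecture.Theorems.WeilTwelvefoldsSqrtMinus7.AmnesicSecantSheaves

/-- **Split fourteenfolds + aimed partner ⟹ `WeilTwelvefoldsSqrtMinus7`.** If (S1) the Hodge–Weil classes are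
algebraic on every complex abelian 14-fold `X` with `ψ ≫ ψ = -7` that is of hyperbolic Weil type for the
`K`-symmetrised hyperplane class `7·e^*a + ψ^*e^*a` of some projective embedding, and (S3 = the aiming lemma at
`d = 7`, `n = 6`) every `ℚ(√-7)`-Weil 12-fold `(A, φ)` carrying a non-zero rational `(6,6)` Weil class has a
partner Weil surface `(B, φ_B)` with a descent pair `(b₊, b₋, η)` and a projective embedding of `A × B` making
`(A × B, φ × φ_B)` hyperbolic in half-dimension `7`, then every rational `(6,6)` Weil class on every
`ℚ(√-7)`-Weil 12-fold is algebraic. Proof: `c = 0` is algebraic; otherwise take the partner, note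
`dim (A × B) = 14` (`dim_prod`) and `(φ × φ_B)² = -7` (`prodLift_comp_self_eq_neg_nsmul`), apply S1 on the
product and descend with `stub_descent` (Schoen 1998 §10 along `complexGysin`) fed by `stub_hodgeTypeExterior`
and `exists_deRhamIsoFamily_holds`. [cite: Schoen1998HodgeWeilAddendum, §10]
[cite: Markman2025SurveySecant, §11.5 Step 2] -/
theorem weilTwelvefolds_of_splitFourteenfolds_of_aimedPartner
    (h14 : ∀ (X : AbelianVariety ℂ) (ψ : X ⟶ X), X.dim = 14 → ψ ≫ ψ = -((7 : ℤ) • 𝟙 X) →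
      ∀ (e : ProjectiveEmbedding X.X) (a : complexBetti (projectiveSpace e.n ℂ) 2),
        IsRationalClass a → a ≠ 0 →
        IsHyperbolicWeilType X ψ 7
          ((7 : ℂ) • complexBetti.map e.ι 2 a + complexBetti.map ψ.hom.hom.hom 2 (complexBetti.map e.ι 2 a)) →
      ∀ c : complexBetti X.X 14, IsRationalClass c → IsOfHodgeType 14 X.X 14 7 7 c →
        c ∈ Module.End.eigenspace (complexBetti.map (𝟙 X + ψ).hom.hom.hom 14).hom
              ((1 + Complex.I * (Real.sqrt (7 : ℝ) : ℂ)) ^ 14) ⊔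
            Module.End.eigenspace (complexBetti.map (𝟙 X + ψ).hom.hom.hom 14).hom
              ((1 - Complex.I * (Real.sqrt (7 : ℝ) : ℂ)) ^ 14) →
        c ∈ algebraicClasses X.X 7)
    (hP : ∀ (A : AbelianVariety ℂ) (φ : A ⟶ A), A.dim = 12 → φ ≫ φ = -((7 : ℤ) • 𝟙 A) →
      (∃ c : complexBetti A.X 12, c ≠ 0 ∧ IsRationalClass c ∧ IsOfHodgeType 12 A.X 12 6 6 c ∧
        c ∈ Module.End.eigenspace (complexBetti.map (𝟙 A + φ).hom.hom.hom 12).hom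
              ((1 + Complex.I * (Real.sqrt (7 : ℝ) : ℂ)) ^ 12) ⊔
            Module.End.eigenspace (complexBetti.map (𝟙 A + φ).hom.hom.hom 12).hom
              ((1 - Complex.I * (Real.sqrt (7 : ℝ) : ℂ)) ^ 12)) →
      ∃ (B : AbelianVariety ℂ) (φB : B ⟶ B), B.dim = 2 ∧ φB ≫ φB = -((7 : ℤ) • 𝟙 B) ∧
        (∃ bp bm η : complexBetti B.X 2,
          bp ∈ Module.End.eigenspace (complexBetti.map (𝟙 B + φB).hom.hom.hom 2).hom
                ((1 + Complex.I * (Real.sqrt (7 : ℝ) : ℂ)) ^ 2) ∧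
          bm ∈ Module.End.eigenspace (complexBetti.map (𝟙 B + φB).hom.hom.hom 2).hom
                ((1 - Complex.I * (Real.sqrt (7 : ℝ) : ℂ)) ^ 2) ∧
          IsRationalClass (bp + bm) ∧ IsOfHodgeType 2 B.X 2 1 1 (bp + bm) ∧
          η ∈ algebraicClasses B.X 1 ∧
          cupProduct (show 2 + 2 = 4 from rfl) bp η ≠ 0 ∧
          cupProduct (show 2 + 2 = 4 from rfl) bm η ≠ 0) ∧
        ∃ (e : ProjectiveEmbedding (A.prod B).X) (a : complexBetti (projectiveSpace e.n ℂ) 2),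
          IsRationalClass a ∧ a ≠ 0 ∧
          IsHyperbolicWeilType (A.prod B)
            (AbelianVariety.prodLift (AbelianVariety.fst A B ≫ φ) (AbelianVariety.snd A B ≫ φB)) 7
            ((7 : ℂ) • complexBetti.map e.ι 2 a +
              complexBetti.map (AbelianVariety.prodLift (AbelianVariety.fst A B ≫ φ)
                (AbelianVariety.snd A B ≫ φB)).hom.hom.hom 2 (complexBetti.map e.ι 2 a))) :
    WeilTwelvefoldsSqrtMinus7 := by
  intro A φ hA hφ c hrat hH hW
  by_cases hc : c = 0
  · rw [hc]
    exact Submodule.zero_mem _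
  obtain ⟨B, φB, hB, hφB, hpair, e, a, har, ha0, hhyp⟩ := hP A φ hA hφ ⟨c, hc, hrat, hH, hW⟩
  have hdim : (A.prod B).dim = 14 := by rw [AbelianVariety.dim_prod, hA, hB]
  have hφ' : φ ≫ φ = -((7 : ℕ) • 𝟙 A) := by rw [hφ, ← natCast_zsmul]; rfl
  have hφB' : φB ≫ φB = -((7 : ℕ) • 𝟙 B) := by rw [hφB, ← natCast_zsmul]; rfl
  have hsq : AbelianVariety.prodLift (AbelianVariety.fst A B ≫ φ) (AbelianVariety.snd A B ≫ φB) ≫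
      AbelianVariety.prodLift (AbelianVariety.fst A B ≫ φ) (AbelianVariety.snd A B ≫ φB) =
        -((7 : ℤ) • 𝟙 (A.prod B)) := by
    rw [prodLift_comp_self_eq_neg_nsmul hφ' hφB', ← natCast_zsmul]; rfl
  exact stub_descent
    (stub_hodgeTypeExterior fun E _ _ _ =>
      Literature.NumberTheory.Transcendental.exists_deRhamIsoFamily_holds E)
    A φ B φB hA hB hφ hφB hpair (h14 (A.prod B) _ hdim hsq e a har ha0 hhyp) c hrat hH hW

/-- **Split fourteenfolds + the aiming lemma of the product trick ⟹ `WeilTwelvefoldsSqrtMinus7`.** The second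
hypothesis is, token for token, the Literature named fact
`Motives.exists_cmWeilSurface_aimedSplitProduct_of_ne_one_of_ne_three` (for every `d > 0`, `d ≠ 1, 3`: a Weil
surface with a descent pair that aims every Weil-type `2n`-fold into the hyperbolic component one dimension up;
van Geemen LNM 1594 Lemma 5.2 (3), 5.3, 5.4 (5.4.1); Markman arXiv:2509.23403 §11.5 Step 2); it is used once, at
`d = 7`, `n = 6`, up to the casts `((7:ℕ):ℤ) = 7`, `((7:ℕ):ℂ) = 7`, `√((7:ℕ):ℝ) = √7`, `2·6 = 12`, `6 + 1 = 7`.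
[cite: vanGeemen1994HodgeAV, Lemma 5.2 (3), 5.3 and 5.4 (5.4.1)] [cite: Markman2025SurveySecant, §11.5 Step 2] -/
theorem weilTwelvefolds_of_splitFourteenfolds_of_aimedSplitProduct
    (h14 : ∀ (X : AbelianVariety ℂ) (ψ : X ⟶ X), X.dim = 14 → ψ ≫ ψ = -((7 : ℤ) • 𝟙 X) →
      ∀ (e : ProjectiveEmbedding X.X) (a : complexBetti (projectiveSpace e.n ℂ) 2),
        IsRationalClass a → a ≠ 0 →
        IsHyperbolicWeilType X ψ 7
          ((7 : ℂ) • complexBetti.map e.ι 2 a + complexBetti.map ψ.hom.hom.hom 2 (complexBetti.map e.ι 2 a)) →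
      ∀ c : complexBetti X.X 14, IsRationalClass c → IsOfHodgeType 14 X.X 14 7 7 c →
        c ∈ Module.End.eigenspace (complexBetti.map (𝟙 X + ψ).hom.hom.hom 14).hom
              ((1 + Complex.I * (Real.sqrt (7 : ℝ) : ℂ)) ^ 14) ⊔
            Module.End.eigenspace (complexBetti.map (𝟙 X + ψ).hom.hom.hom 14).hom
              ((1 - Complex.I * (Real.sqrt (7 : ℝ) : ℂ)) ^ 14) →
        c ∈ algebraicClasses X.X 7)
    (hAim : ∀ d : ℕ, 0 < d → d ≠ 1 → d ≠ 3 →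
      ∃ (B : AbelianVariety ℂ) (ψ : B ⟶ B), B.dim = 2 ∧ ψ ≫ ψ = -((d : ℤ) • 𝟙 B) ∧
        (∃ bp bm η : complexBetti B.X 2,
          bp ∈ Module.End.eigenspace (complexBetti.map (𝟙 B + ψ).hom.hom.hom 2).hom
                ((1 + Complex.I * (Real.sqrt (d : ℝ) : ℂ)) ^ 2) ∧
          bm ∈ Module.End.eigenspace (complexBetti.map (𝟙 B + ψ).hom.hom.hom 2).hom
                ((1 - Complex.I * (Real.sqrt (d : ℝ) : ℂ)) ^ 2) ∧
          IsRationalClass (bp + bm) ∧ IsOfHodgeType 2 B.X 2 1 1 (bp + bm) ∧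
          η ∈ algebraicClasses B.X 1 ∧
          cupProduct (show 2 + 2 = 4 from rfl) bp η ≠ 0 ∧
          cupProduct (show 2 + 2 = 4 from rfl) bm η ≠ 0) ∧
        ∀ (n : ℕ) (A : AbelianVariety ℂ) (φ : A ⟶ A), A.dim = 2 * n →
          φ ≫ φ = -((d : ℤ) • 𝟙 A) →
          (∃ c : complexBetti A.X (2 * n), c ≠ 0 ∧ IsRationalClass c ∧
            IsOfHodgeType (2 * n) A.X (2 * n) n n c ∧
            c ∈ Module.End.eigenspace (complexBetti.map (𝟙 A + φ).hom.hom.hom (2 * n)).hom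
                  ((1 + Complex.I * (Real.sqrt (d : ℝ) : ℂ)) ^ (2 * n)) ⊔
                Module.End.eigenspace (complexBetti.map (𝟙 A + φ).hom.hom.hom (2 * n)).hom
                  ((1 - Complex.I * (Real.sqrt (d : ℝ) : ℂ)) ^ (2 * n))) →
          ∃ (e : ProjectiveEmbedding (A.prod B).X)
            (a : complexBetti (projectiveSpace e.n ℂ) 2),
            IsRationalClass a ∧ a ≠ 0 ∧
            IsHyperbolicWeilType (A.prod B)
              (AbelianVariety.prodLift (AbelianVariety.fst A B ≫ φ) (AbelianVariety.snd A B ≫ ψ))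
              (n + 1)
              ((d : ℂ) • complexBetti.map e.ι 2 a +
                complexBetti.map (AbelianVariety.prodLift (AbelianVariety.fst A B ≫ φ)
                  (AbelianVariety.snd A B ≫ ψ)).hom.hom.hom 2 (complexBetti.map e.ι 2 a))) :
    WeilTwelvefoldsSqrtMinus7 := by
  refine weilTwelvefolds_of_splitFourteenfolds_of_aimedPartner h14 fun A φ hA hφ hc => ?_
  obtain ⟨B, φB, hB, hφB, hpair, haim⟩ := hAim 7 (by norm_num) (by norm_num) (by norm_num)
  refine ⟨B, φB, hB, by simpa using hφB, by simpa using hpair, ?_⟩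
  have hφ' : φ ≫ φ = -(((7 : ℕ) : ℤ) • 𝟙 A) := by simpa using hφ
  obtain ⟨e, a, ha, ha0, hhyp⟩ := haim 6 A φ hA hφ' (by simpa using hc)
  exact ⟨e, a, ha, ha0, by simpa using hhyp⟩

end Summit.HodgeConjecture.HodgeConjecture.Theorems.WeilTwelvefoldsSqrtMinus7.AmnesicSecantSheaves

end
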